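import Mathlib
import Summits.Ventures.PercRepro2.TypedUntouched

/-!
# The untouched-mark vanishing: `o` and `b` must be touched too (blind cell PercRepro2, night-3 g5,
2026-08-25; `proofs/NIGHT3-CERT.md` §14)

The `S₃`-symmetrised kernel `K₃` vanishes on every state triple in which the three copies share the
status of `o` (`(L_o, H_o)` common) — with NO condition on `Q` or on the other coordinates
(`KBsym_eq_zero_of_o`, 131,072 triples: the `Q`-failing ones by `KB_eq_zero_of_q'`, the rest a
`decide` over 16,384 cases) — and likewise for `b` (`KBsym_eq_zero_of_b`).  Hence, as in
`TypedUntouched.lean`, every typed base vanishes when no typed edge touches the pinned cluster of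
`o` (`typedCount_eq_zero_of_untouched_o`) or of `b` (`typedCount_eq_zero_of_untouched_b`).

**Equality-locus theorem** (`exists_touching_four_of_typedCount_ne_zero`): a NONZERO typed base of
row 2′TRI has a typed edge at each of the four pinned clusters `C_z(a₁)`, `C_z(a₂)`, `C_z(o)`,
`C_z(b)`.  The mark `a₃` is exempt: with `a₃` untouched the typed base is the two-copy (BASE)
family (`TypedA3Inactive.lean`), which is nonzero in general (the `a = 2` instance `o = b ∈ X`,
edges `X–a₁`, `X–a₂`, `a₃` isolated has `S = 4`), and the kernel identity fails on 2,952 of the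
131,072 triples with a common `a₃`-status.

Mechanism of the `o`-vanishing (paper): with `u_o` frozen the covariance pieces with a
`σ_o`-difference vanish, `[pd u_o](x)·Cov(σ_b, σ₃)` cancels `pd(x)·Cov(σ_b, σ₃ u_o)`, and the
remaining `pd(x)·P4 + (1_Q − pd)(x)·P2` is `u_o·Σ ± pd(i)·[pd u_b](j)` over ordered pairs of
copies, which the `S₃`-symmetrisation kills — the `P2` mass of the spectators with `a₃ ∈ U` pays
exactly the `P4` cross mass of the `PD`-spectators.
-/

namespace Summit.Ventures.PercRepro2

open UnionCluster

namespace CovForm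

namespace Untouched

open OneTyped TypedA3

/-! ## The symmetrised kernel when a copy fails `Q`, and when `o` / `b` are frozen -/

section States

/-- The symmetrised kernel vanishes as soon as one of the three states fails `Q`. -/
theorem KBsym_eq_zero_of_q' (x y z : St) (h : x.q' = true ∨ y.q' = true ∨ z.q' = true) :
    KBsym x y z = 0 := by
  unfold KBsym
  rcases h with h | h | h
  · rw [KB_eq_zero_of_q' x y z (Or.inl h), KB_eq_zero_of_q' x z y (Or.inl h),
      KB_eq_zero_of_q' y x z (Or.inr (Or.inl h)), KB_eq_zero_of_q' y z x (Or.inr (Or.inr h)),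
      KB_eq_zero_of_q' z x y (Or.inr (Or.inl h)), KB_eq_zero_of_q' z y x (Or.inr (Or.inr h))]
    rfl
  · rw [KB_eq_zero_of_q' x y z (Or.inr (Or.inl h)), KB_eq_zero_of_q' x z y (Or.inr (Or.inr h)),
      KB_eq_zero_of_q' y x z (Or.inl h), KB_eq_zero_of_q' y z x (Or.inl h),
      KB_eq_zero_of_q' z x y (Or.inr (Or.inr h)), KB_eq_zero_of_q' z y x (Or.inr (Or.inl h))]
    rfl
  · rw [KB_eq_zero_of_q' x y z (Or.inr (Or.inr h)), KB_eq_zero_of_q' x z y (Or.inr (Or.inl h)),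
      KB_eq_zero_of_q' y x z (Or.inr (Or.inr h)), KB_eq_zero_of_q' y z x (Or.inr (Or.inl h)),
      KB_eq_zero_of_q' z x y (Or.inl h), KB_eq_zero_of_q' z y x (Or.inl h)]
    rfl

/-- The `Q`-satisfying core of the `o`-identity (16,384 cases). -/
theorem KBsym_eq_zero_of_o_core (Lo Ho Lbx L3x Hbx H3x Lby L3y Hby H3y Lbw L3w Hbw H3w : Bool) :
    KBsym (mkSt false Lo Lbx L3x Ho Hbx H3x) (mkSt false Lo Lby L3y Ho Hby H3y)
      (mkSt false Lo Lbw L3w Ho Hbw H3w) = 0 := by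
  revert Lo Ho Lbx L3x Hbx H3x Lby L3y Hby H3y Lbw L3w Hbw H3w
  decide +kernel

/-- **The symmetrised kernel vanishes when the three copies share the status of `o`** (no
condition on `Q`). -/
theorem KBsym_eq_zero_of_o (qx qy qw Lo Ho Lbx L3x Hbx H3x Lby L3y Hby H3y Lbw L3w Hbw H3w :
    Bool) :
    KBsym (mkSt qx Lo Lbx L3x Ho Hbx H3x) (mkSt qy Lo Lby L3y Ho Hby H3y)
      (mkSt qw Lo Lbw L3w Ho Hbw H3w) = 0 := by
  cases qx
  · cases qy
    · cases qw
      · exact KBsym_eq_zero_of_o_core Lo Ho Lbx L3x Hbx H3x Lby L3y Hby H3y Lbw L3w Hbw H3w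
      · exact KBsym_eq_zero_of_q' _ _ _ (Or.inr (Or.inr rfl))
    · exact KBsym_eq_zero_of_q' _ _ _ (Or.inr (Or.inl rfl))
  · exact KBsym_eq_zero_of_q' _ _ _ (Or.inl rfl)

/-- The `Q`-satisfying core of the `b`-identity (16,384 cases). -/
theorem KBsym_eq_zero_of_b_core (Lb Hb Lox L3x Hox H3x Loy L3y Hoy H3y Low L3w How H3w : Bool) :
    KBsym (mkSt false Lox Lb L3x Hox Hb H3x) (mkSt false Loy Lb L3y Hoy Hb H3y)
      (mkSt false Low Lb L3w How Hb H3w) = 0 := by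
  revert Lb Hb Lox L3x Hox H3x Loy L3y Hoy H3y Low L3w How H3w
  decide +kernel

/-- **The symmetrised kernel vanishes when the three copies share the status of `b`** (no
condition on `Q`). -/
theorem KBsym_eq_zero_of_b (qx qy qw Lb Hb Lox L3x Hox H3x Loy L3y Hoy H3y Low L3w How H3w :
    Bool) :
    KBsym (mkSt qx Lox Lb L3x Hox Hb H3x) (mkSt qy Loy Lb L3y Hoy Hb H3y)
      (mkSt qw Low Lb L3w How Hb H3w) = 0 := by
  cases qx
  · cases qy
    · cases qw
      · exact KBsym_eq_zero_of_b_core Lb Hb Lox L3x Hox H3x Loy L3y Hoy H3y Low L3w How H3w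
      · exact KBsym_eq_zero_of_q' _ _ _ (Or.inr (Or.inr rfl))
    · exact KBsym_eq_zero_of_q' _ _ _ (Or.inr (Or.inl rfl))
  · exact KBsym_eq_zero_of_q' _ _ _ (Or.inl rfl)

end States

/-! ## The states on the support when `o` / `b` is untouched -/

section StateSupport

open Classical

variable {V : Type*} {E : Type*} [Fintype E] [DecidableEq E]
variable (ends : E → Sym2 V) (o a₁ a₂ a₃ b : V)

omit [Fintype E] [DecidableEq E] in
/-- A root connection of an untouched mark is its pinned one. -/
lemma conn_root_iff_of_untouchedBy {F : Finset E} {z : Config E} {v : V}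
    (h : UntouchedBy ends F z v) {ω : Config E} (hω : ∀ e, e ∉ F → ω e = z e) (r : V) :
    Conn ends ω r v ↔ Conn ends z r v := by
  constructor
  · intro hc; exact conn_symm ((conn_iff_of_untouchedBy h hω r).1 (conn_symm hc))
  · intro hc; exact conn_symm ((conn_iff_of_untouchedBy h hω r).2 (conn_symm hc))

omit [Fintype E] [DecidableEq E] in
/-- With `C(o)` untouched, the state of `ω` has the `o`-status of `z`. -/
lemma st_eq_mkSt_of_untouched_o {F : Finset E} {z : Config E}
    (h : UntouchedBy ends F z o) {ω : Config E} (hω : ∀ e, e ∉ F → ω e = z e) :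
    st ends o a₁ a₂ a₃ b ω =
      mkSt (decide (Conn ends ω a₂ a₁)) (decide (Conn ends z a₁ o)) (decide (Conn ends ω a₁ b))
        (decide (Conn ends ω a₁ a₃)) (decide (Conn ends z a₂ o)) (decide (Conn ends ω a₂ b))
        (decide (Conn ends ω a₂ a₃)) := by
  unfold st mkSt
  rw [decide_eq_decide.mpr (conn_root_iff_of_untouchedBy ends h hω a₁),
    decide_eq_decide.mpr (conn_root_iff_of_untouchedBy ends h hω a₂)]

omit [Fintype E] [DecidableEq E] in
/-- With `C(b)` untouched, the state of `ω` has the `b`-status of `z`. -/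
lemma st_eq_mkSt_of_untouched_b {F : Finset E} {z : Config E}
    (h : UntouchedBy ends F z b) {ω : Config E} (hω : ∀ e, e ∉ F → ω e = z e) :
    st ends o a₁ a₂ a₃ b ω =
      mkSt (decide (Conn ends ω a₂ a₁)) (decide (Conn ends ω a₁ o)) (decide (Conn ends z a₁ b))
        (decide (Conn ends ω a₁ a₃)) (decide (Conn ends ω a₂ o)) (decide (Conn ends z a₂ b))
        (decide (Conn ends ω a₂ a₃)) := by
  unfold st mkSt
  rw [decide_eq_decide.mpr (conn_root_iff_of_untouchedBy ends h hω a₁),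
    decide_eq_decide.mpr (conn_root_iff_of_untouchedBy ends h hω a₂)]

end StateSupport

/-! ## The theorems -/

section Main

open Classical

variable {V : Type*} {E : Type*} [Fintype E] [DecidableEq E] {R : Type*} [Field R]
  [LinearOrder R] [IsStrictOrderedRing R]
variable (ends : E → Sym2 V) (o a₁ a₂ a₃ b : V)

/-- **Untouched-`o` vanishing**: if no typed edge touches the pinned cluster of `o`, the typed
base vanishes. -/
theorem typedCount_eq_zero_of_untouched_o (F : Finset E) (z : Config E) (τ : E → ℕ)
    (hτ : ∀ e ∈ F, τ e = 1 ∨ τ e = 2) (h : UntouchedBy ends F z o) :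
    typedCount F z τ (K3 ends o a₁ a₂ a₃ b : Config E → Config E → Config E → R) = 0 := by
  have h6 := six_mul_typedCount F z τ hτ (K3 ends o a₁ a₂ a₃ b : Config E → Config E → Config E → R)
  have hzero : typedCount F z τ (fun x y w : Config E =>
      (K3 ends o a₁ a₂ a₃ b x y w : R) + K3 ends o a₁ a₂ a₃ b x w y + K3 ends o a₁ a₂ a₃ b y x w +
        K3 ends o a₁ a₂ a₃ b y w x + K3 ends o a₁ a₂ a₃ b w x y + K3 ends o a₁ a₂ a₃ b w y x) =
      typedCount F z τ (fun _ _ _ => (0 : R)) := by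
    refine typedCount_congr_on_support F z τ fun x y w hxyw _ => ?_
    have hx : ∀ e, e ∉ F → x e = z e := fun e he => (hxyw e he).1
    have hy : ∀ e, e ∉ F → y e = z e := fun e he => (hxyw e he).2.1
    have hw : ∀ e, e ∉ F → w e = z e := fun e he => (hxyw e he).2.2
    simp only [K3_eq_KB ends o a₁ a₂ a₃ b, st_eq_mkSt_of_untouched_o ends o a₁ a₂ a₃ b h hx,
      st_eq_mkSt_of_untouched_o ends o a₁ a₂ a₃ b h hy,
      st_eq_mkSt_of_untouched_o ends o a₁ a₂ a₃ b h hw]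
    have := KBsym_eq_zero_of_o (decide (Conn ends x a₂ a₁)) (decide (Conn ends y a₂ a₁))
      (decide (Conn ends w a₂ a₁)) (decide (Conn ends z a₁ o)) (decide (Conn ends z a₂ o))
      (decide (Conn ends x a₁ b)) (decide (Conn ends x a₁ a₃)) (decide (Conn ends x a₂ b))
      (decide (Conn ends x a₂ a₃))
      (decide (Conn ends y a₁ b)) (decide (Conn ends y a₁ a₃)) (decide (Conn ends y a₂ b))
      (decide (Conn ends y a₂ a₃))
      (decide (Conn ends w a₁ b)) (decide (Conn ends w a₁ a₃)) (decide (Conn ends w a₂ b))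
      (decide (Conn ends w a₂ a₃))
    unfold KBsym at this
    exact_mod_cast this
  rw [hzero, typedCount_zero_kernel] at h6
  have h6' : (6 : R) ≠ 0 := by norm_num
  exact (mul_eq_zero.mp h6).resolve_left h6'

/-- **Untouched-`b` vanishing**: if no typed edge touches the pinned cluster of `b`, the typed
base vanishes. -/
theorem typedCount_eq_zero_of_untouched_b (F : Finset E) (z : Config E) (τ : E → ℕ)
    (hτ : ∀ e ∈ F, τ e = 1 ∨ τ e = 2) (h : UntouchedBy ends F z b) :
    typedCount F z τ (K3 ends o a₁ a₂ a₃ b : Config E → Config E → Config E → R) = 0 := by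
  have h6 := six_mul_typedCount F z τ hτ (K3 ends o a₁ a₂ a₃ b : Config E → Config E → Config E → R)
  have hzero : typedCount F z τ (fun x y w : Config E =>
      (K3 ends o a₁ a₂ a₃ b x y w : R) + K3 ends o a₁ a₂ a₃ b x w y + K3 ends o a₁ a₂ a₃ b y x w +
        K3 ends o a₁ a₂ a₃ b y w x + K3 ends o a₁ a₂ a₃ b w x y + K3 ends o a₁ a₂ a₃ b w y x) =
      typedCount F z τ (fun _ _ _ => (0 : R)) := by
    refine typedCount_congr_on_support F z τ fun x y w hxyw _ => ?_
    have hx : ∀ e, e ∉ F → x e = z e := fun e he => (hxyw e he).1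
    have hy : ∀ e, e ∉ F → y e = z e := fun e he => (hxyw e he).2.1
    have hw : ∀ e, e ∉ F → w e = z e := fun e he => (hxyw e he).2.2
    simp only [K3_eq_KB ends o a₁ a₂ a₃ b, st_eq_mkSt_of_untouched_b ends o a₁ a₂ a₃ b h hx,
      st_eq_mkSt_of_untouched_b ends o a₁ a₂ a₃ b h hy,
      st_eq_mkSt_of_untouched_b ends o a₁ a₂ a₃ b h hw]
    have := KBsym_eq_zero_of_b (decide (Conn ends x a₂ a₁)) (decide (Conn ends y a₂ a₁))
      (decide (Conn ends w a₂ a₁)) (decide (Conn ends z a₁ b)) (decide (Conn ends z a₂ b))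
      (decide (Conn ends x a₁ o)) (decide (Conn ends x a₁ a₃)) (decide (Conn ends x a₂ o))
      (decide (Conn ends x a₂ a₃))
      (decide (Conn ends y a₁ o)) (decide (Conn ends y a₁ a₃)) (decide (Conn ends y a₂ o))
      (decide (Conn ends y a₂ a₃))
      (decide (Conn ends w a₁ o)) (decide (Conn ends w a₁ a₃)) (decide (Conn ends w a₂ o))
      (decide (Conn ends w a₂ a₃))
    unfold KBsym at this
    exact_mod_cast this
  rw [hzero, typedCount_zero_kernel] at h6
  have h6' : (6 : R) ≠ 0 := by norm_num
  exact (mul_eq_zero.mp h6).resolve_left h6'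

/-- **The four marks `a₁, a₂, o, b` must all be touched**: a nonzero typed base has a typed edge
at each of their pinned clusters. -/
theorem exists_touching_four_of_typedCount_ne_zero (F : Finset E) (z : Config E) (τ : E → ℕ)
    (hτ : ∀ e ∈ F, τ e = 1 ∨ τ e = 2)
    (hne : typedCount F z τ (K3 ends o a₁ a₂ a₃ b : Config E → Config E → Config E → R) ≠ 0) :
    (∃ e ∈ F, e ∈ touches ends (cluster ends z a₁)) ∧
      (∃ e ∈ F, e ∈ touches ends (cluster ends z a₂)) ∧
      (∃ e ∈ F, e ∈ touches ends (cluster ends z o)) ∧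
      (∃ e ∈ F, e ∈ touches ends (cluster ends z b)) := by
  obtain ⟨h1, h2⟩ := exists_touching_of_typedCount_ne_zero ends o a₁ a₂ a₃ b F z τ hτ hne
  refine ⟨h1, h2, ?_, ?_⟩
  · by_contra hc
    exact hne (typedCount_eq_zero_of_untouched_o ends o a₁ a₂ a₃ b F z τ hτ
      fun e he ht => hc ⟨e, he, ht⟩)
  · by_contra hc
    exact hne (typedCount_eq_zero_of_untouched_b ends o a₁ a₂ a₃ b F z τ hτ
      fun e he ht => hc ⟨e, he, ht⟩)

end Main

end Untouched

end CovForm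

end Summit.Ventures.PercRepro2
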